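import Summits.BirchSwinnertonDyer.BirchSwinnertonDyer.Theorems.BiquadraticEisensteinDescentHeegnerTwistCouplingInSupplyIndefinitePinCorner
import Literature.NumberTheory.QuadraticFields.BinaryQuadraticFormsClassNumberCount
import HarnessLib

set_option linter.dupNamespace false -- `Summit.BirchSwinnertonDyer.BirchSwinnertonDyer.Theorems.…` (summit = sub)
set_option autoImplicit false

/-!
# Crux `HeegnerTwistCouplingInSupply` (stmt-BirchSwinnertonDyer-21381) — the TWO-SIDED PARTNER LADDER for the corner
# `W = E_p`, `p ≡ 7 (mod 8)`: generic rungs with a FIXED small partner prime on either side of Monsky's odd cell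

Route `BiquadraticEisensteinDescent` (cell `pub/bsd-wall`, width seat `bsd-wall-cm-bed-w4` g12; `--supports` 21381, helper).
Item (i) of `Cruxes/HeegnerTwistCouplingInSupply/LEAD-VERDICT-ibd-p1-g11.md` §4. The row-1 Monsky cell for `E_{pqℓ}` is
`{p ≡ 7, q ≡ 3, ℓ ≡ 5 (mod 8)}` with `(ℓ/p) = −1` (tree `det_monskyMatrixOdd_cell_seven_mod_eight`; the determinant does not
see `(q/p)`), the Heegner field of `N(E_p) = 32p²` is `K′ = ℚ(√−qℓ)` (`−qℓ ≡ 1 (mod 8)`: `2` splits; `(−qℓ/p) = (q/p)`: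
`p` splits iff `(q/p) = +1`), and `h(K′) < p` needs `qℓ = O(p)`: ONE of the two cell primes must be `O(1)`. The tree has the
two cheapest rungs — partner `q = 3` (g10 p645024: `p ≡ 2 (mod 3)`, three-squares pin `ℓ < 2p`) and partner `ℓ = 5`
(g11 p649700: `p ≡ ±2 (mod 5)`, indefinite pin `q ≤ 10p`). This file makes BOTH rungs GENERIC in the fixed partner:

* §3 `cruxOnEpCornerPartnerQ_of_facts` — **q-side rung**: any prime `q₀ ≡ 3 (mod 8)`; every prime `p ≡ 7 (mod 8)` with
  `(p/q₀) = −1` and `p ≥ P`, where `8⁸(2q₀)⁵ ≤ (2.718·3.1415)⁸P³`: the three-squares pin `ℓ < 2p` (p642610) closes the cell,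
  `K′ = ℚ(√−q₀ℓ)`, `|d| < 2q₀·p`, `h(K′) < p` by the class number formula bound (tree `classNumber_lt_of_sqrt_mul_log_lt` +
  p649242's lever `inv_pi_mul_sqrt_mul_log_lt_of_lt_mul` with `c = 2q₀`);
* §4 `cruxOnEpCornerPartnerL_of_facts` — **ℓ-side rung**: any prime `ℓ₀ ≡ 5 (mod 8)`; every prime `p ≡ 7 (mod 8)` with
  `(ℓ₀/p) = −1` and `p ≥ P ≥ 800`, where `8⁸(10ℓ₀)⁵ ≤ (2.718·3.1415)⁸P³`: the indefinite `(3,+)` pin `q ≤ 10p` (p648070)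
  closes the cell, `K′ = ℚ(√−qℓ₀)`, `|d| < 10ℓ₀·p`;
* §2 the common field half `exists_witnessField_of` and the two class-number certificates (`classNumber_lt_of_lever`,
  `classNumber_lt_of_count` — the latter reads a kernel value of Cohen's pair counter `BinQF.classNumberCount`, for the rung
  tables below the thresholds in the sequel `…PartnerLadderRungs`).

All corner statements are modulo the SAME five named facts as p645024 / p649700 (Modularity `exists_isNewformOf`, Monsky's
matrix theorem (odd), Burungale–Tian, Deuring–Hecke `hasEntireLFunction_of_j_mem_maximalCMJInvariants`, Burungale–Flach) and
nothing else. The thresholds: `P(q₀) ≈ 2.2·q₀^{5/3}` (`q₀ = 11: 146`, `19: 362`, `43: 1409`), `P(ℓ₀) ≈ 32·ℓ₀^{5/3}`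
(`ℓ₀ = 13: 2805`). HONEST FRAMING: a prime `p ≡ 7 (mod 8)` escapes every rung of height `H` iff `p` is a residue mod every
prime `q ≡ 3 (mod 8)`, `q ≤ H` and every prime `ℓ ≡ 5 (mod 8)`, `ℓ ≤ H` is a residue mod `p` (density `2^{−π(H; 8, {3,5})}`
of the family) — the ladder never covers all `p`; the crux itself (all CM `W` of analytic rank one) is untouched; BSD is not
proved by any of this. THEOREMS ONLY (no definition, no named fact, no `sorry`). Supports stmt-BirchSwinnertonDyer-21381.
-/

namespace Summit.BirchSwinnertonDyer.BirchSwinnertonDyer.Theorems.BiquadraticEisensteinDescentHeegnerTwistCouplingInSupplyPartnerLadder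

open Literature.NumberTheory.EllipticCurves Literature.NumberTheory.EllipticCurves.HeathBrown1994
  Literature.NumberTheory.EllipticCurves.HeathBrown1994.Families
  Literature.NumberTheory.QuadraticFields Literature.NumberTheory.QuadraticFields.Quadratic
  Summit.BirchSwinnertonDyer.BirchSwinnertonDyer.Theorems.BiquadraticEisensteinDescentHeegnerTwistCouplingInSupplyThreeSquaresPin
  Summit.BirchSwinnertonDyer.BirchSwinnertonDyer.Theorems.BiquadraticEisensteinDescentHeegnerTwistCouplingInSupplyMonskyCells
  Summit.BirchSwinnertonDyer.BirchSwinnertonDyer.Theorems.BiquadraticEisensteinDescentHeegnerTwistCouplingInSupplyThreeSquaresPinRankZero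
  Summit.BirchSwinnertonDyer.BirchSwinnertonDyer.Theorems.BiquadraticEisensteinDescentHeegnerTwistCouplingInSupplySizeIndivisibleSharp
  Summit.BirchSwinnertonDyer.BirchSwinnertonDyer.Theorems.BiquadraticEisensteinDescentHeegnerTwistCouplingInSupplyThreeSquaresPinCorner
  Summit.BirchSwinnertonDyer.BirchSwinnertonDyer.Theorems.BiquadraticEisensteinDescentHeegnerTwistCouplingInSupplyIndefinitePin
  Summit.BirchSwinnertonDyer.BirchSwinnertonDyer.Theorems.BiquadraticEisensteinDescentHeegnerTwistCouplingInSupplyPartnerTables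
  Summit.BirchSwinnertonDyer.BirchSwinnertonDyer.Theorems.BiquadraticEisensteinDescentHeegnerTwistCouplingInSupplyIndefinitePinWitness

/-! ## §1 Symbols -/

/-- `(ℓ/p) = −1` from a brute-force table datum: `ℓ ≡ 1 (mod 4)` prime, `p` odd, `p` a non-residue mod `ℓ`
(reciprocity `(ℓ/p) = (p/ℓ)`). [folklore] -/
theorem jacobiSym_eq_neg_one_of_table_one_mod_four {p l : ℕ} (hl : l.Prime) (hl4 : l % 4 = 1) (hp2 : p % 2 = 1)
    (h : ∀ x < l, x * x % l ≠ p % l) : jacobiSym (l : ℤ) p = -1 := by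
  rw [jacobiSym.quadratic_reciprocity_one_mod_four hl4 (Nat.odd_iff.mpr hp2)]
  exact jacobiSym_eq_neg_one_of_forall_sq_ne hl h

/-- `(q/p) = +1` from `(p/q) = −1` for `p, q ≡ 3 (mod 4)` (reciprocity `(q/p) = −(p/q)`). [folklore] -/
theorem jacobiSym_eq_one_of_jacobiSym_eq_neg_one {p q : ℕ} (hp4 : p % 4 = 3) (hq4 : q % 4 = 3)
    (h : jacobiSym (p : ℤ) q = -1) : jacobiSym (q : ℤ) p = 1 := by
  rw [jacobiSym.quadratic_reciprocity_three_mod_four hq4 hp4, h]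
  norm_num

/-- `(−qℓ/p) = +1` in the row-1 cell: `p ≡ 3 (mod 4)`, `(q/p) = +1`, `(ℓ/p) = −1`. [folklore] -/
theorem jacobiSym_neg_mul_eq_one {p q l : ℕ} (hp4 : p % 4 = 3) (hq : jacobiSym (q : ℤ) p = 1)
    (hl : jacobiSym (l : ℤ) p = -1) : jacobiSym (-((q * l : ℕ) : ℤ)) p = 1 := by
  have hm1 : jacobiSym (-1) p = -1 := DeuringLadic.jacobiSym_neg_one_of_mod_four hp4
  have : (-((q * l : ℕ) : ℤ)) = (-1) * (q : ℤ) * (l : ℤ) := by push_cast; ring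
  rw [this, jacobiSym.mul_left, jacobiSym.mul_left, hm1, hq, hl]
  norm_num

/-! ## §2 The field half: `K′ = ℚ(√−qℓ)`, Heegner for levels supported on `{2, p}`, and two certificates for `h(K′) < p` -/

/-- **The witness field of the row-1 cell.** For primes `q ≡ 3 (mod 8)`, `ℓ ≡ 5 (mod 8)` and a prime `p` with
`(−qℓ/p) = +1`, given any bound `h(·) < p` valid for every imaginary quadratic field of discriminant `−qℓ`:
`K′ = ℚ(√−qℓ)` is imaginary quadratic, `d_{K′} = −qℓ ≡ 1 (mod 8)`, Heegner for every level whose prime divisors lie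
in `{2, p}`, and `h(K′) < p`. [cite: Marcus2018, Ch. 2 Thm. 1; Ch. 3 Thm. 25] -/
theorem exists_witnessField_of {p q l : ℕ} (hq : q.Prime) (hq8 : q % 8 = 3) (hl : l.Prime) (hl8 : l % 8 = 5)
    (hJ : jacobiSym (-((q * l : ℕ) : ℤ)) p = 1)
    (hh : ∀ (K : Type) [Field K] [NumberField K], IsImaginaryQuadratic K →
      NumberField.discr K = -((q * l : ℕ) : ℤ) → NumberField.classNumber K < p)
    {N : ℕ} (hN : ∀ r : ℕ, r.Prime → r ∣ N → r = 2 ∨ r = p) :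
    ∃ (K : Type) (_ : Field K) (_ : NumberField K),
      IsImaginaryQuadratic K ∧ NumberField.discr K = -((q * l : ℕ) : ℤ) ∧
      SatisfiesHeegnerHypothesis N K ∧ NumberField.classNumber K < p := by
  have hql : q ≠ l := by rintro rfl; omega
  haveI : Fact ((-((q * l : ℕ) : ℤ)) < 0) := ⟨by have := hq.two_le; have := hl.two_le; push_cast; nlinarith⟩
  have hsf : Squarefree (-((q * l : ℕ) : ℤ)).natAbs := by
    rw [Int.natAbs_neg, Int.natAbs_natCast, Nat.squarefree_mul ((Nat.coprime_primes hq hl).mpr hql)]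
    exact ⟨hq.squarefree, hl.squarefree⟩
  have hD8 : (-((q * l : ℕ) : ℤ)) % 8 = 1 := by
    have : (q * l) % 8 = 7 := by rw [Nat.mul_mod, hq8, hl8]
    omega
  obtain ⟨hK, hdK⟩ := isImaginaryQuadratic_and_discr_sqrtField_of_squarefree_natAbs (-((q * l : ℕ) : ℤ))
    (by omega) hsf
  refine ⟨sqrtField (-((q * l : ℕ) : ℤ)), inferInstance, inferInstance, hK, hdK, ?_, hh _ hK hdK⟩
  refine satisfiesHeegnerHypothesis_sqrtField_of_squarefree_natAbs _ hD8 hsf fun r hr hrN => ?_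
  rcases hN r hr hrN with rfl | rfl
  · exact Or.inl rfl
  · exact Or.inr hJ

/-- **Certificate 1 (kernel value): `h(K′) < p` from Cohen's pair counter** — every imaginary quadratic `K` with
`d_K = −qℓ` has `h_K = h(−qℓ) = classNumberCount(qℓ)`. [cite: Cox2013, §2.A Thm. 2.13; §7.B Thm. 7.7(ii)]
[cite: Cohen1993, §5.3.1 Algorithm 5.3.5] -/
theorem classNumber_lt_of_count {p q l : ℕ} (hq : q.Prime) (hl : l.Prime)
    (hh : BinQF.classNumberCount (q * l) < p) :
    ∀ (K : Type) [Field K] [NumberField K], IsImaginaryQuadratic K →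
      NumberField.discr K = -((q * l : ℕ) : ℤ) → NumberField.classNumber K < p := by
  intro K _ _ hK hdK
  have hneg : (-((q * l : ℕ) : ℤ)) < 0 := by have := hq.two_le; have := hl.two_le; push_cast; nlinarith
  rw [ClassNumberValues.classNumber_eq_of_discr_eq hK.1 hdK hneg rfl, BinQF.classNumber_eq_classNumberCount hneg,
    Int.natAbs_neg, Int.natAbs_natCast]
  exact hh

/-- **Certificate 2 (size): `h(K′) < p` from the class number formula bound when `qℓ < c·p` above the threshold**
`8⁸c⁵ ≤ (2.718·3.1415)⁸P³`, `P ≤ p` (Oesterlé `h ≤ π⁻¹√|d| log|d|`, tree; lever p649242).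
[cite: Oesterle1988Gauss, II §3 Proposition p. 57 (27)] -/
theorem classNumber_lt_of_lever {p q l : ℕ} (hq : q.Prime) (hl : l.Prime) (hl8 : l % 8 = 5) {c : ℝ} {P : ℕ}
    (hxc : ((q * l : ℕ) : ℝ) < c * p) (hkey : (8 : ℝ) ^ 8 * c ^ 5 ≤ (2.718 * 3.1415) ^ 8 * (P : ℝ) ^ 3)
    (hP : P ≤ p) :
    ∀ (K : Type) [Field K] [NumberField K], IsImaginaryQuadratic K →
      NumberField.discr K = -((q * l : ℕ) : ℤ) → NumberField.classNumber K < p := by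
  intro K _ _ hK hdK
  have h4 : 4 < (NumberField.discr K).natAbs := by
    rw [hdK, Int.natAbs_neg, Int.natAbs_natCast]
    have := hq.two_le
    have : 5 ≤ l := by have := hl.two_le; omega
    nlinarith
  have hP0 : (0 : ℝ) < P := by
    rcases Nat.eq_zero_or_pos P with rfl | hpos
    · exfalso
      have hc : (0 : ℝ) < c := by
        have h0 : (0 : ℝ) ≤ ((q * l : ℕ) : ℝ) := by positivity
        have hp0 : (0 : ℝ) ≤ (p : ℝ) := by positivity
        nlinarith
      have : (0 : ℝ) < (8 : ℝ) ^ 8 * c ^ 5 := by positivity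
      norm_num at hkey
      linarith
    · exact_mod_cast hpos
  refine classNumber_lt_of_sqrt_mul_log_lt hK h4 ?_
  rw [hdK, Int.natAbs_neg, Int.natAbs_natCast]
  refine inv_pi_mul_sqrt_mul_log_lt_of_lt_mul (c := c) (P := (P : ℝ)) ?_ hxc hkey hP0 (by exact_mod_cast hP)
  have := hq.two_le
  have := hl.two_le
  positivity

/-! ## §3 The `L`-half of the row-1 cell and the generic q-side rung (three-squares pin, fixed `q₀ ≡ 3 (mod 8)`) -/

/-- **Row-1 cell, any partners**: `p ≡ 7 (mod 8)`, `q ≡ 3 (mod 8)`, `ℓ ≡ 5 (mod 8)` primes, `(ℓ/p) = −1`, `q ≠ p` ⇒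
`E_{p·qℓ}` has analytic rank `0` and `L(E_{pqℓ}, 1) ≠ 0` (Monsky odd determinant `= 1`, then the journal door).
[cite: HeathBrown1994SelmerCongruentII, Appendix (Monsky), typescript p. 39 L27–L33] [cite: BurungaleTian2026, Thm. 1.1]
[cite: BurungaleFlach2024, Thm. 1.1 and Cor. 2] -/
theorem analyticRank_eq_zero_odd_cell (hM : monsky_card_selmerGroup_two_odd)
    (hBT : burungaleTian_analyticRank_eq_zero_of_selmerCorank_eq_zero_of_hasCM)
    (hH : hasEntireLFunction_of_j_mem_maximalCMJInvariants) (hBF : bsdTriple_of_hasCM_of_L_one_ne_zero)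
    {p q l : ℕ} (hp : p.Prime) (hp8 : p % 8 = 7) (hq : q.Prime) (hq8 : q % 8 = 3) (hl : l.Prime) (hl8 : l % 8 = 5)
    (hlp : jacobiSym (l : ℤ) p = -1) (hqp : q ≠ p) :
    Squarefree (p * (q * l)) ∧ (congruentNumberCurve (p * (q * l))).BSDTriple ∧
      (congruentNumberCurve (p * (q * l))).analyticRank = 0 ∧
      (congruentNumberCurve (p * (q * l))).entireLFunction 1 ≠ 0 := by
  have hdet := det_monskyMatrixOdd_cell_seven_mod_eight (p := p) hp hq hl hp8 hq8 hl8 hlp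
  have hlp' : l ≠ p := ne_of_jacobiSym_ne_zero hp (by rw [hlp]; norm_num)
  have hql : q ≠ l := by rintro rfl; omega
  exact analyticRank_eq_zero_of_det_odd hM hBT hH hBF hp hq hl (by omega) (by omega) (by omega)
    (Ne.symm hqp) (Ne.symm hlp') hql hdet

/-- **GENERIC q-SIDE RUNG.** Fix a prime `q₀ ≡ 3 (mod 8)` and `P` with `8⁸(2q₀)⁵ ≤ (2.718·3.1415)⁸P³`. Modulo Modularity +
Monsky (odd) + Burungale–Tian + Deuring–Hecke + Burungale–Flach: for every prime `p ≡ 7 (mod 8)` with `(p/q₀) = −1` and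
`p ≥ P`, the three-squares pin `ℓ < 2p` (`ℓ ≡ 5 (mod 8)`, `(ℓ/p) = −1`) and the Heegner field `K′ = ℚ(√−q₀ℓ)` of
`N(E_p) = 32p²` with `L(E_p^{(−q₀ℓ)}, 1) ≠ 0` and `h(K′) < p`. (`q₀ = 3` is p645024's `CruxOnEpCornerMod24`.)
[cite: HeathBrown1994SelmerCongruentII, Appendix (Monsky), typescript p. 39 L27–L33] [cite: BurungaleTian2026, Thm. 1.1]
[cite: BurungaleFlach2024, Thm. 1.1 and Cor. 2] [cite: Oesterle1988Gauss, II §3 Proposition p. 57 (27)] -/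
theorem cruxOnEpCornerPartnerQ_of_facts (hmod : ModularForms.exists_isNewformOf) (hM : monsky_card_selmerGroup_two_odd)
    (hBT : burungaleTian_analyticRank_eq_zero_of_selmerCorank_eq_zero_of_hasCM)
    (hH : hasEntireLFunction_of_j_mem_maximalCMJInvariants) (hBF : bsdTriple_of_hasCM_of_L_one_ne_zero)
    {q₀ : ℕ} (hq₀ : q₀.Prime) (hq₀8 : q₀ % 8 = 3) {P : ℕ}
    (hkey : (8 : ℝ) ^ 8 * ((2 * q₀ : ℕ) : ℝ) ^ 5 ≤ (2.718 * 3.1415) ^ 8 * (P : ℝ) ^ 3) :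
    ∀ (p : ℕ) [Fact p.Prime] [(congruentNumberCurve p).IsElliptic]
      [(congruentNumberCurve p).IsGloballyMinimal] [NeZero ((congruentNumberCurve p).conductorNorm ℤ)],
      p % 8 = 7 → jacobiSym (p : ℤ) q₀ = -1 → P ≤ p →
      ∃ (ℓ : ℕ) (K : Type) (_ : Field K) (_ : NumberField K),
        ℓ.Prime ∧ ℓ < 2 * p ∧ ℓ % 8 = 5 ∧ jacobiSym (ℓ : ℤ) p = -1 ∧
        IsImaginaryQuadratic K ∧ NumberField.discr K = -((q₀ * ℓ : ℕ) : ℤ) ∧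
        SatisfiesHeegnerHypothesis ((congruentNumberCurve p).conductorNorm ℤ) K ∧
        ((congruentNumberCurve p).quadraticTwist (NumberField.discr K : ℚ)).entireLFunction 1 ≠ 0 ∧
        NumberField.classNumber K < p := by
  intro p hpF _ _ _ hp8 hJq hPp
  have hp : p.Prime := hpF.out
  have hp4 : p % 4 = 3 := by omega
  obtain ⟨ℓ, hℓ, hℓlt, hℓ8, hJℓ⟩ := threeSquaresPin p hp hp4
  have hJq' : jacobiSym (q₀ : ℤ) p = 1 := jacobiSym_eq_one_of_jacobiSym_eq_neg_one hp4 (by omega) hJq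
  have hq₀p : q₀ ≠ p := ne_of_jacobiSym_ne_zero hp (by rw [hJq']; norm_num)
  obtain ⟨-, -, -, hL⟩ := analyticRank_eq_zero_odd_cell hM hBT hH hBF hp hp8 hq₀ hq₀8 hℓ hℓ8 hJℓ hq₀p
  have hN : (congruentNumberCurve p).conductorNorm ℤ = 32 * p ^ 2 :=
    conductorNorm_congruentNumberCurve_of_odd hmod hp.squarefree (Nat.odd_iff.mpr (by omega))
  have hxc : ((q₀ * ℓ : ℕ) : ℝ) < ((2 * q₀ : ℕ) : ℝ) * p := by
    have h1 : q₀ * ℓ < 2 * q₀ * p := by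
      have := hq₀.pos
      nlinarith
    exact_mod_cast h1
  obtain ⟨K, iF, iN, hK, hdK, hH', hcl⟩ := exists_witnessField_of (N := (congruentNumberCurve p).conductorNorm ℤ)
    hq₀ hq₀8 hℓ hℓ8 (jacobiSym_neg_mul_eq_one hp4 hJq' hJℓ) (classNumber_lt_of_lever hq₀ hℓ hℓ8 hxc hkey hPp)
    (fun r hr hrN => eq_two_or_eq_of_prime_dvd_thirtyTwo_mul_sq hp hr (hN ▸ hrN))
  refine ⟨ℓ, K, iF, iN, hℓ, hℓlt, hℓ8, hJℓ, hK, hdK, hH', ?_, hcl⟩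
  rw [hdK, quadraticTwist_congruentNumberCurve, Int.natAbs_neg, Int.natAbs_natCast, ← mul_assoc p q₀ ℓ, mul_assoc]
  exact hL

/-- **q-side rung below the threshold, from a table row**: the same conclusion for a prime `p ≡ 7 (mod 8)` with
`(p/q₀) = −1`, given a partner `ℓ ≡ 5 (mod 8)` prime, `ℓ < 2p`, `p` a non-residue mod `ℓ`, with the kernel value
`classNumberCount(q₀ℓ) < p`. [cite: Cox2013, §2.A Thm. 2.13] [cite: HeathBrown1994SelmerCongruentII, Appendix (Monsky), typescript p. 39 L27–L33] -/
theorem cruxOnEpCornerPartnerQ_of_row (hmod : ModularForms.exists_isNewformOf) (hM : monsky_card_selmerGroup_two_odd)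
    (hBT : burungaleTian_analyticRank_eq_zero_of_selmerCorank_eq_zero_of_hasCM)
    (hH : hasEntireLFunction_of_j_mem_maximalCMJInvariants) (hBF : bsdTriple_of_hasCM_of_L_one_ne_zero)
    {q₀ : ℕ} (hq₀ : q₀.Prime) (hq₀8 : q₀ % 8 = 3)
    {p : ℕ} [Fact p.Prime] [(congruentNumberCurve p).IsElliptic]
    [(congruentNumberCurve p).IsGloballyMinimal] [NeZero ((congruentNumberCurve p).conductorNorm ℤ)]
    (hp8 : p % 8 = 7) (hJq : jacobiSym (p : ℤ) q₀ = -1)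
    {ℓ : ℕ} (hℓ : ℓ.Prime) (hℓ8 : ℓ % 8 = 5) (hℓlt : ℓ < 2 * p) (hres : ∀ x < ℓ, x * x % ℓ ≠ p % ℓ)
    (hh : BinQF.classNumberCount (q₀ * ℓ) < p) :
    ∃ (ℓ : ℕ) (K : Type) (_ : Field K) (_ : NumberField K),
      ℓ.Prime ∧ ℓ < 2 * p ∧ ℓ % 8 = 5 ∧ jacobiSym (ℓ : ℤ) p = -1 ∧
      IsImaginaryQuadratic K ∧ NumberField.discr K = -((q₀ * ℓ : ℕ) : ℤ) ∧
      SatisfiesHeegnerHypothesis ((congruentNumberCurve p).conductorNorm ℤ) K ∧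
      ((congruentNumberCurve p).quadraticTwist (NumberField.discr K : ℚ)).entireLFunction 1 ≠ 0 ∧
      NumberField.classNumber K < p := by
  have hp : p.Prime := Fact.out
  have hp4 : p % 4 = 3 := by omega
  have hJℓ : jacobiSym (ℓ : ℤ) p = -1 := jacobiSym_eq_neg_one_of_table_one_mod_four hℓ (by omega) (by omega) hres
  have hJq' : jacobiSym (q₀ : ℤ) p = 1 := jacobiSym_eq_one_of_jacobiSym_eq_neg_one hp4 (by omega) hJq
  have hq₀p : q₀ ≠ p := ne_of_jacobiSym_ne_zero hp (by rw [hJq']; norm_num)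
  obtain ⟨-, -, -, hL⟩ := analyticRank_eq_zero_odd_cell hM hBT hH hBF hp hp8 hq₀ hq₀8 hℓ hℓ8 hJℓ hq₀p
  have hN : (congruentNumberCurve p).conductorNorm ℤ = 32 * p ^ 2 :=
    conductorNorm_congruentNumberCurve_of_odd hmod hp.squarefree (Nat.odd_iff.mpr (by omega))
  obtain ⟨K, iF, iN, hK, hdK, hH', hcl⟩ := exists_witnessField_of (N := (congruentNumberCurve p).conductorNorm ℤ)
    hq₀ hq₀8 hℓ hℓ8 (jacobiSym_neg_mul_eq_one hp4 hJq' hJℓ) (classNumber_lt_of_count hq₀ hℓ hh)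
    (fun r hr hrN => eq_two_or_eq_of_prime_dvd_thirtyTwo_mul_sq hp hr (hN ▸ hrN))
  refine ⟨ℓ, K, iF, iN, hℓ, hℓlt, hℓ8, hJℓ, hK, hdK, hH', ?_, hcl⟩
  rw [hdK, quadraticTwist_congruentNumberCurve, Int.natAbs_neg, Int.natAbs_natCast, ← mul_assoc p q₀ ℓ, mul_assoc]
  exact hL

/-! ## §4 The generic ℓ-side rung (indefinite `(3,+)` pin, fixed `ℓ₀ ≡ 5 (mod 8)`) -/

/-- **GENERIC ℓ-SIDE RUNG.** Fix a prime `ℓ₀ ≡ 5 (mod 8)` and `P ≥ 800` with `8⁸(10ℓ₀)⁵ ≤ (2.718·3.1415)⁸P³`. Modulo the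
same five named facts: for every prime `p ≡ 7 (mod 8)` with `(ℓ₀/p) = −1` and `p ≥ P`, the indefinite pin `q ≤ 10p`
(`q ≡ 3 (mod 8)` prime, `(q/p) = +1`) and the Heegner field `K′ = ℚ(√−qℓ₀)` of `N(E_p)` with `L(E_p^{(−qℓ₀)}, 1) ≠ 0`
and `h(K′) < p`. (`ℓ₀ = 5` is p649700's `cruxOnEpCornerCellA_of_facts` above `800`.)
[cite: HeathBrown1994SelmerCongruentII, Appendix (Monsky), typescript p. 39 L27–L33] [cite: BurungaleTian2026, Thm. 1.1]
[cite: BurungaleFlach2024, Thm. 1.1 and Cor. 2] [cite: Oesterle1988Gauss, II §3 Proposition p. 57 (27)] -/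
theorem cruxOnEpCornerPartnerL_of_facts (hmod : ModularForms.exists_isNewformOf) (hM : monsky_card_selmerGroup_two_odd)
    (hBT : burungaleTian_analyticRank_eq_zero_of_selmerCorank_eq_zero_of_hasCM)
    (hH : hasEntireLFunction_of_j_mem_maximalCMJInvariants) (hBF : bsdTriple_of_hasCM_of_L_one_ne_zero)
    {ℓ₀ : ℕ} (hℓ₀ : ℓ₀.Prime) (hℓ₀8 : ℓ₀ % 8 = 5) {P : ℕ} (hP800 : 800 ≤ P)
    (hkey : (8 : ℝ) ^ 8 * ((10 * ℓ₀ : ℕ) : ℝ) ^ 5 ≤ (2.718 * 3.1415) ^ 8 * (P : ℝ) ^ 3) :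
    ∀ (p : ℕ) [Fact p.Prime] [(congruentNumberCurve p).IsElliptic]
      [(congruentNumberCurve p).IsGloballyMinimal] [NeZero ((congruentNumberCurve p).conductorNorm ℤ)],
      p % 8 = 7 → jacobiSym (ℓ₀ : ℤ) p = -1 → P ≤ p →
      ∃ (q : ℕ) (K : Type) (_ : Field K) (_ : NumberField K),
        q.Prime ∧ q ≤ 10 * p ∧ q % 8 = 3 ∧ jacobiSym (q : ℤ) p = 1 ∧
        IsImaginaryQuadratic K ∧ NumberField.discr K = -((q * ℓ₀ : ℕ) : ℤ) ∧
        SatisfiesHeegnerHypothesis ((congruentNumberCurve p).conductorNorm ℤ) K ∧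
        ((congruentNumberCurve p).quadraticTwist (NumberField.discr K : ℚ)).entireLFunction 1 ≠ 0 ∧
        NumberField.classNumber K < p := by
  intro p hpF _ _ _ hp8 hJℓ hPp
  have hp : p.Prime := hpF.out
  have hp4 : p % 4 = 3 := by omega
  obtain ⟨q, hq, hq8, hJq, hqle⟩ := indefinitePinThreePlus hp hp4 (hP800.trans hPp)
  have hqp : q ≠ p := ne_of_jacobiSym_ne_zero hp (by rw [hJq]; norm_num)
  obtain ⟨-, -, -, hL⟩ := analyticRank_eq_zero_odd_cell hM hBT hH hBF hp hp8 hq hq8 hℓ₀ hℓ₀8 hJℓ hqp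
  have hN : (congruentNumberCurve p).conductorNorm ℤ = 32 * p ^ 2 :=
    conductorNorm_congruentNumberCurve_of_odd hmod hp.squarefree (Nat.odd_iff.mpr (by omega))
  have hxc : ((q * ℓ₀ : ℕ) : ℝ) < ((10 * ℓ₀ : ℕ) : ℝ) * p := by
    have hqlt : q < 10 * p := by
      rcases hqle.lt_or_eq with h | h
      · exact h
      · exfalso; omega
    have h1 : q * ℓ₀ < 10 * ℓ₀ * p := by
      have := hℓ₀.pos
      nlinarith
    exact_mod_cast h1
  obtain ⟨K, iF, iN, hK, hdK, hH', hcl⟩ := exists_witnessField_of (N := (congruentNumberCurve p).conductorNorm ℤ)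
    hq hq8 hℓ₀ hℓ₀8 (jacobiSym_neg_mul_eq_one hp4 hJq hJℓ) (classNumber_lt_of_lever hq hℓ₀ hℓ₀8 hxc hkey hPp)
    (fun r hr hrN => eq_two_or_eq_of_prime_dvd_thirtyTwo_mul_sq hp hr (hN ▸ hrN))
  refine ⟨q, K, iF, iN, hq, hqle, hq8, hJq, hK, hdK, hH', ?_, hcl⟩
  rw [hdK, quadraticTwist_congruentNumberCurve, Int.natAbs_neg, Int.natAbs_natCast, ← mul_assoc p q ℓ₀, mul_assoc]
  exact hL

/-- **ℓ-side rung below the threshold, from a table row**: a partner `q ≡ 3 (mod 8)` prime with `p` a non-residue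
mod `q` (so `(q/p) = +1`) and the kernel value `classNumberCount(qℓ₀) < p`.
[cite: Cox2013, §2.A Thm. 2.13] [cite: HeathBrown1994SelmerCongruentII, Appendix (Monsky), typescript p. 39 L27–L33] -/
theorem cruxOnEpCornerPartnerL_of_row (hmod : ModularForms.exists_isNewformOf) (hM : monsky_card_selmerGroup_two_odd)
    (hBT : burungaleTian_analyticRank_eq_zero_of_selmerCorank_eq_zero_of_hasCM)
    (hH : hasEntireLFunction_of_j_mem_maximalCMJInvariants) (hBF : bsdTriple_of_hasCM_of_L_one_ne_zero)
    {ℓ₀ : ℕ} (hℓ₀ : ℓ₀.Prime) (hℓ₀8 : ℓ₀ % 8 = 5)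
    {p : ℕ} [Fact p.Prime] [(congruentNumberCurve p).IsElliptic]
    [(congruentNumberCurve p).IsGloballyMinimal] [NeZero ((congruentNumberCurve p).conductorNorm ℤ)]
    (hp8 : p % 8 = 7) (hJℓ : jacobiSym (ℓ₀ : ℤ) p = -1)
    {q : ℕ} (hq : q.Prime) (hq8 : q % 8 = 3) (hqle : q ≤ 10 * p) (hres : ∀ x < q, x * x % q ≠ p % q)
    (hh : BinQF.classNumberCount (q * ℓ₀) < p) :
    ∃ (q : ℕ) (K : Type) (_ : Field K) (_ : NumberField K),
      q.Prime ∧ q ≤ 10 * p ∧ q % 8 = 3 ∧ jacobiSym (q : ℤ) p = 1 ∧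
      IsImaginaryQuadratic K ∧ NumberField.discr K = -((q * ℓ₀ : ℕ) : ℤ) ∧
      SatisfiesHeegnerHypothesis ((congruentNumberCurve p).conductorNorm ℤ) K ∧
      ((congruentNumberCurve p).quadraticTwist (NumberField.discr K : ℚ)).entireLFunction 1 ≠ 0 ∧
      NumberField.classNumber K < p := by
  have hp : p.Prime := Fact.out
  have hp4 : p % 4 = 3 := by omega
  have hJq : jacobiSym (q : ℤ) p = 1 := jacobiSym_eq_one_of_table hq hp4 hq8 hres
  have hqp : q ≠ p := ne_of_jacobiSym_ne_zero hp (by rw [hJq]; norm_num)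
  obtain ⟨-, -, -, hL⟩ := analyticRank_eq_zero_odd_cell hM hBT hH hBF hp hp8 hq hq8 hℓ₀ hℓ₀8 hJℓ hqp
  have hN : (congruentNumberCurve p).conductorNorm ℤ = 32 * p ^ 2 :=
    conductorNorm_congruentNumberCurve_of_odd hmod hp.squarefree (Nat.odd_iff.mpr (by omega))
  obtain ⟨K, iF, iN, hK, hdK, hH', hcl⟩ := exists_witnessField_of (N := (congruentNumberCurve p).conductorNorm ℤ)
    hq hq8 hℓ₀ hℓ₀8 (jacobiSym_neg_mul_eq_one hp4 hJq hJℓ) (classNumber_lt_of_count hq hℓ₀ hh)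
    (fun r hr hrN => eq_two_or_eq_of_prime_dvd_thirtyTwo_mul_sq hp hr (hN ▸ hrN))
  refine ⟨q, K, iF, iN, hq, hqle, hq8, hJq, hK, hdK, hH', ?_, hcl⟩
  rw [hdK, quadraticTwist_congruentNumberCurve, Int.natAbs_neg, Int.natAbs_natCast, ← mul_assoc p q ℓ₀, mul_assoc]
  exact hL

end Summit.BirchSwinnertonDyer.BirchSwinnertonDyer.Theorems.BiquadraticEisensteinDescentHeegnerTwistCouplingInSupplyPartnerLadder
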